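import Summits.Ventures.PercRepro.ProfilePointedAvoidRow

/-!
# PercRepro — THE `p`-GIRTH REGIME OF THE POINTED CONJECTURE: (Ĉ) HOLDS AT EVERY LEVEL `k` AT WHICH EVERY `(k+1)`-SUBSET
THROUGH `p` IS INDEPENDENT, MODULO THEOREM A FOR THE CONTRACTION `M / p` ALONE (p10, gen 25)

In the `p`-girth regime (every `(k+1)`-subset through `p` independent — `p` lies in no circuit with at most `k + 1`
elements) every `p`-avoiding bi-independent `k`-set extends by `p`, so `out_k = c^p_k = P_k(M / p)`
(`extCount_eq_outCount_of_indep_succ_mem`, ProfilePointedAvoidRow).  Conjecture (D) at that level therefore reads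
`(N − k − 1)·P_k(M/p) ≤ (k + 1)·out_{k+1}`, and since `c^p_{k+1} ≤ out_{k+1}` it FOLLOWS from Theorem A for the
contraction `M / p` on `N − 1` elements: `(N − 1 − k)·P_k(M/p) ≤ (k + 1)·P_{k+1}(M/p)` (the named fact; at
`2k + 2 = N` the symmetry `P_k = P_{k+1}` of a profile on `2k + 1` elements).  With
`pointedRow_level_of_avoidRow_of_indep_succ_mem` this gives:

* `avoidRow_level_of_indep_succ_mem_of_fact` — (D) at `(M, p, k)` in the `p`-girth regime, mod Theorem A for `M / p`;
* `pointedRow_level_of_indep_succ_mem_of_fact` — **(Ĉ) at `(M, p, k)` whenever every `(k+1)`-subset through `p` is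
  independent**, mod Theorem A for `M / p`;
* `pointedRowAt_of_indep_half_mem_of_fact` — (Ĉ) at every level of `(M, p)` when `p` lies in no circuit with at most
  `N/2` elements;
* `exists_dependent_mem_of_not_pointedRow_level_of_fact`, `MinimalWitness.exists_dependent_mem` — **a failure of (Ĉ) at
  level `k` needs a dependent `(k+1)`-set THROUGH `p`; a minimal witness fails at such a level** — mod Theorem A.

The open part of (Ĉ) is now the CAPTURE regime: levels `k` at which some `(k+1)`-set through `p` is dependent, i.e.
`p` lies in a circuit with at most `k + 1 ≤ N/2` elements.  Nothing here asserts (Ĉ) or (D).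
-/

open scoped Matroid

namespace PercRepro.Cogirth

open Finset ThmH Skew

variable {α : Type} [DecidableEq α] {M : Matroid α} [M.Finite]

omit [DecidableEq α] in
/-- In the `p`-girth regime with `2k + 2 ≤ N` the point `p` is not a loop. -/
theorem indep_singleton_of_indep_succ_mem {k : ℕ} {p : α} (hp : p ∈ gr M) (hk : 2 * k + 2 ≤ (gr M).card)
    (h1 : ∀ X ⊆ gr M, p ∈ X → X.card = k + 1 → rk M X = X.card) : M.Indep {p} := by
  obtain ⟨X, hpX, hXg, hXc⟩ := exists_subsuperset_card_eq (singleton_subset_iff.2 hp)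
    (show ({p} : Finset α).card ≤ k + 1 by rw [card_singleton]; omega) (by omega)
  have hX := h1 X hXg (hpX (mem_singleton_self p)) hXc
  have := rk_eq_card_of_subset_of_rk_eq_card hpX hX
  have h2 := indep_of_rk_eq_card' this
  simpa using h2

/-- **Theorem A for `M / p` at level `k`, in `extCount` form** (mod the named fact): `(N − 1 − k)·c^p_k ≤ (k + 1)·c^p_{k+1}`
for `2k + 2 ≤ N` (at `2k + 2 = N` by the symmetry of the profile of `M / p` on `2k + 1` elements). -/
theorem extCount_thmA_of_fact (hfact : BiIndepDensityLogConcave α) {p : α} (hp : p ∈ gr M) (hp1 : M.Indep {p})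
    (k : ℕ) (hk : 2 * k + 2 ≤ (gr M).card) :
    ((gr M).card - 1 - k) * extCount M k p ≤ (k + 1) * extCount M (k + 1) p := by
  rw [extCount_eq_card_biIndepSets_contract hp1 k, extCount_eq_card_biIndepSets_contract hp1 (k + 1)]
  have hN : (gr (M ／ ({p} : Set α))).card = (gr M).card - 1 := by
    rw [gr_contract', card_erase_of_mem hp]
  obtain ⟨m, hm⟩ := Nat.exists_eq_add_of_le hk
  rcases Nat.eq_zero_or_pos m with rfl | hm1
  · have hs := card_biIndepSets_symm (M ／ ({p} : Set α)) (k := k) (by rw [hN]; omega)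
    rw [hN, hm, show 2 * k + 2 + 0 - 1 - k = k + 1 by omega] at hs
    rw [hs, hm, show 2 * k + 2 + 0 - 1 - k = k + 1 by omega]
  · have h := biIndepDensity_mono_of_fact hfact (M ／ ({p} : Set α)) k (by rw [hN]; omega)
    rw [hN] at h
    exact h

/-- **(D) IN THE `p`-GIRTH REGIME, MOD THEOREM A FOR `M / p`**: if every `(k+1)`-subset through `p` is independent,
`(N − k − 1)·out_k ≤ (k + 1)·out_{k+1}`. -/
theorem avoidRow_level_of_indep_succ_mem_of_fact (hfact : BiIndepDensityLogConcave α) {k : ℕ} {p : α}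
    (hp : p ∈ gr M) (hk : 2 * k + 2 ≤ (gr M).card)
    (h1 : ∀ X ⊆ gr M, p ∈ X → X.card = k + 1 → rk M X = X.card) :
    ((gr M).card - k - 1) * outCount M k p ≤ (k + 1) * outCount M (k + 1) p := by
  rw [← extCount_eq_outCount_of_indep_succ_mem hp h1]
  have h2 := extCount_thmA_of_fact hfact hp (indep_singleton_of_indep_succ_mem hp hk h1) k hk
  have h3 : extCount M (k + 1) p ≤ outCount M (k + 1) p := by
    have := capCount_add_extCount (M := M) (k + 1) hp
    omega
  calc ((gr M).card - k - 1) * extCount M k p = ((gr M).card - 1 - k) * extCount M k p := by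
        rw [show (gr M).card - k - 1 = (gr M).card - 1 - k by omega]
    _ ≤ (k + 1) * extCount M (k + 1) p := h2
    _ ≤ (k + 1) * outCount M (k + 1) p := Nat.mul_le_mul_left _ h3

/-- **(Ĉ) IN THE `p`-GIRTH REGIME** (mod Theorem A for `M / p`): if every `(k+1)`-subset through `p` is independent and
`2k + 2 ≤ N`, then `(N − k − 1)·P_k ≤ k·P_{k+1} + (N − 2k − 1)·c^p_k`. -/
theorem pointedRow_level_of_indep_succ_mem_of_fact (hfact : BiIndepDensityLogConcave α) {k : ℕ} {p : α}
    (hp : p ∈ gr M) (hk : 2 * k + 2 ≤ (gr M).card)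
    (h1 : ∀ X ⊆ gr M, p ∈ X → X.card = k + 1 → rk M X = X.card) :
    ((gr M).card - k - 1) * (biIndepSets M k).card ≤
      k * (biIndepSets M (k + 1)).card + ((gr M).card - 2 * k - 1) * extCount M k p :=
  pointedRow_level_of_avoidRow_of_indep_succ_mem hk hp h1 (avoidRow_level_of_indep_succ_mem_of_fact hfact hp hk h1)

/-- (Ĉ) at every level of `(M, p)` when every subset through `p` with at most `N/2` elements is independent — `p` lies in
no circuit with at most `N/2` elements (mod Theorem A). -/
theorem pointedRowAt_of_indep_half_mem_of_fact (hfact : BiIndepDensityLogConcave α) {p : α} (hp : p ∈ gr M)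
    (h : ∀ X ⊆ gr M, p ∈ X → 2 * X.card ≤ (gr M).card → rk M X = X.card) : PointedRowAt M p := by
  intro k hk
  exact pointedRow_level_of_indep_succ_mem_of_fact hfact hp hk (fun X hX hpX hXc => h X hX hpX (by omega))

/-- A failure of (Ĉ) at level `k` needs a dependent `(k+1)`-subset THROUGH `p` (mod Theorem A). -/
theorem exists_dependent_mem_of_not_pointedRow_level_of_fact (hfact : BiIndepDensityLogConcave α) {k : ℕ} {p : α}
    (hp : p ∈ gr M) (hk : 2 * k + 2 ≤ (gr M).card)
    (hfail : ¬ (((gr M).card - k - 1) * (biIndepSets M k).card ≤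
      k * (biIndepSets M (k + 1)).card + ((gr M).card - 2 * k - 1) * extCount M k p)) :
    ∃ X ⊆ gr M, p ∈ X ∧ X.card = k + 1 ∧ rk M X < k + 1 := by
  by_contra hcon
  apply hfail
  apply pointedRow_level_of_indep_succ_mem_of_fact hfact hp hk
  intro X hX hpX hXc
  apply le_antisymm (by rw [hXc]; exact (rk_le_card X).trans hXc.le)
  exact not_lt.1 (fun hlt => hcon ⟨X, hX, hpX, hXc, hXc ▸ hlt⟩)

/-- **A minimal witness fails (Ĉ) at a level `k` at which some `(k+1)`-set THROUGH `p` is dependent** — `p` lies in a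
circuit with at most `k + 1 ≤ N/2` elements (mod Theorem A). -/
theorem MinimalWitness.exists_dependent_mem (hfact : BiIndepDensityLogConcave α) {p : α} (h : MinimalWitness M p) :
    ∃ k, 2 * k + 2 ≤ (gr M).card ∧
      ¬ (((gr M).card - k - 1) * (biIndepSets M k).card ≤
        k * (biIndepSets M (k + 1)).card + ((gr M).card - 2 * k - 1) * extCount M k p) ∧
      ∃ X ⊆ gr M, p ∈ X ∧ X.card = k + 1 ∧ rk M X < k + 1 := by
  obtain ⟨hp, hM, -⟩ := h
  obtain ⟨k, hk, hfail⟩ : ∃ k, 2 * k + 2 ≤ (gr M).card ∧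
      ¬ (((gr M).card - k - 1) * (biIndepSets M k).card ≤
        k * (biIndepSets M (k + 1)).card + ((gr M).card - 2 * k - 1) * extCount M k p) := by
    by_contra hcon
    exact hM (fun k hk => by_contra (fun hf => hcon ⟨k, hk, hf⟩))
  exact ⟨k, hk, hfail, exists_dependent_mem_of_not_pointedRow_level_of_fact hfact hp hk hfail⟩

end PercRepro.Cogirth
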